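/-
Copyright (c) 2026 the pub-hodgecm-mathlib formalisation cell (harness21).  Prover seat hodgecm-mathlib-LH1-p02 (g3): line LH4 bankable brick
(J3) «σ_w-NORM DICHOTOMY AT EVERY NON-SPLIT PLACE» (LH4-plan (g3) DEALER WORD #31, after LH5-p02 (g3)'s (b1) NORM-INDEX-TWO census, ★ (J1) p850388 and
★ (J2) p850325); 2026-09-02.
-/
import Literature.NumberTheory.LocalFields.QuadraticPlaceNormIndexTwo   -- ★ (J1) `index_range_norm_place_eq_two_of_smul_eq`; brings ★ (J2) `QuadraticLocalNormFixedRange` (`galAdicCompletionMap_algebraMap_place`, `exists_algebraMap_place_eq_of_card_eq_two`, `algebraMap_norm_place_eq_mul_of_card_eq_two`) and ★ `SemiLocalShapiro`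
import HarnessLib

/-!
# The norm dichotomy `F_v = N(E_w) ⊔ ε · N(E_w)` at a non-split place of a quadratic extension of number fields, in `σ_w`-currency
# (Neukirch ANT V (1.1) `i = 0` + the two cosets of an index-two subgroup; Cassels–Fröhlich VII §1.1; for CM fields `L ∕ L⁺` at EVERY non-split place)

Topic `NumberTheory/LocalFields`; namespace `Literature.NumberTheory.LocalFields`.  THEOREMS ONLY (no definition, no instance, no notation, no named
fact, no `sorry`).  Cell `pub/hodgecm-mathlib` (D-0151), crux H413 = `stmt-HodgeConjecture-24833`, line LH4 (dyadic ∕ wild pay-down road of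
`stub_N6nsDyadic`): the JUNCTION (J3) of LH5-p02 (g3)'s (b1) «NORM INDEX TWO» census (`F0/P3c/LH5/LH5-p02/g3/NORM-INDEX-TWO-CENSUS.md` §2).  From
★ (J1) `Literature.NumberTheory.LocalFields.index_range_norm_place_eq_two_of_smul_eq` (`[F_vˣ : N_{E_w∕F_v} E_wˣ] = 2` at a place fixed by the
non-trivial automorphism of a quadratic `E ∕ F` — unramified, tame or WILD alike; LCFT-free Herbrand road) and Mathlib's two-coset description of an index-two
subgroup (`Subgroup.index_eq_two_iff_exists_notMem_and'`, `Subgroup.mul_mem_iff_of_index_two`), pushed into `E_w` by ★ (J2) (`Fix(σ_w) = algebraMap F_v`,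
`N x = x · σ_w x`): there is a `σ_w`-fixed non-zero `ε ∈ F_v ⊆ E_w` which is NOT of the form `z · σ_w z`, and every `σ_w`-fixed non-zero `s` is EITHER `z · σ_w z`
OR `ε · (z · σ_w z)` (exclusively).  This is the shape of ★ `UnitaryGroup.exists_fixed_unit_norm_dichotomy_of_ramified_complexConj` ∕ the `hdich` hypothesis
of ★ `UnitaryGroup.sq_zero_unipotent_cases_of_ramified_complexConj` (`Automorphic/UnitaryThreeUnipotentClassesRamifiedPlace.lean`, TAME places, `|2|_w = 1`)
MINUS its unit clauses (`|ε|_w = 1`, `|ε − σ z · z|_w = 1`), now at EVERY non-split place — so a wild twin of the singular-unipotent-class road can be fed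
without the `hv2`∕`he` hypotheses.  (The unit-level refinement `[𝒪_vˣ : N 𝒪_wˣ] = e(w|v)` is a separate statement, census §2 last bullet; not here.)
HONEST LABEL: HC_CM is proved only modulo the 7 printed citations (2 remaining: hLiu418 24832, h413 24833) until rung 0 closes; this file is unconditional
local algebra, count-neutral (`--supports stmt-HodgeConjecture-24833`).

SETTING (as ★ (J1)∕(J2)).  `E ∕ F` a finite Galois extension of number fields (`F E : Type`), `v` a finite place of `F`, `w : SemiLocal.Place F E v` (the subtype
`{w // w.under (𝓞 F) = v}` = `UnitaryGroup.PlacesOver E v`), `F_v = v.adicCompletion F`, `E_w = (w : HeightOneSpectrum (𝓞 E)).adicCompletion E` with the ★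
algebra structure `SemiLocal.algebraPlace w`; `#Gal(E∕F) = 2`, `c ≠ 1`, `c • w = w` (NON-SPLIT), `σ_w = galAdicCompletionMap c hw : E_w →+* E_w`.  The norm
subgroup is `N = (Units.map (Algebra.norm F_v : E_w →* F_v)).range ≤ F_vˣ` (the spelling of ★ (J1) and of the class field axiom).

* §1 `mem_range_unitsMap_norm_place_iff` — `y ∈ N ↔ ∃ z : E_w, z · σ_w z = algebraMap y` (the norm subgroup read in `E_w`).
* §2 **`exists_fixed_nonnorm_trichotomy_of_card_eq_two`** (master form: `ε ∈ algebraMap F_v`, `σ_w ε = ε`, `ε ≠ 0`, `ε` not a `z · σ_w z`, and for every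
  `σ_w`-fixed `s ≠ 0` EXACTLY ONE of «`s = z · σ_w z`» ∕ «`ε · s = z · σ_w z` (equivalently `s = ε · (z · σ_w z)`)»);
  **`exists_fixed_nonnorm_dichotomy_of_card_eq_two`** (the census text (J3)); **`exists_fixed_nonnorm_dichotomy_of_card_eq_two'`** (the consumer shape of
  ★ `exists_fixed_unit_norm_dichotomy_of_ramified_complexConj`: `(¬ ∃ t, t · σ t = ε) ∧ ∀ s, s ≠ 0 → σ s = s → ∃ z, z ≠ 0 ∧ (s = z · σ z ∨ s = ε · (z · σ z))`);
  `exists_mul_galAdicCompletionMap_eq_mul_of_not_exists` (the product of two `σ_w`-fixed non-norms is a norm).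
* §3 CM fields `L ∕ L⁺` (`c = IsCMField.complexConj L`, `w : SemiLocal.Place L⁺ L v` = `UnitaryGroup.PlacesOver L v`, `hw : complexConj L • w = w`):
  **`IsCMField.exists_fixed_nonnorm_dichotomy`**, **`IsCMField.exists_fixed_nonnorm_dichotomy'`** (consumer shape), `IsCMField.exists_fixed_nonnorm_trichotomy`,
  and the `Subsingleton (PlacesOver L v)`-frame `IsCMField.exists_fixed_nonnorm_dichotomy_of_subsingleton'` (the LH4 leaf's `hsub`).
USAGE from `UnitaryGroup.PlacesOver` currency: as ★ (J1)∕(J2) — pass `w : UnitaryGroup.PlacesOver L v` ITSELF for the `Place` argument (same subtype) and the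
consumer's own `hw`; `σ_w` then prints as the consumer's `galAdicCompletionMap (IsCMField.complexConj L) hw` (proof-irrelevant in `hw`).

## References
* J. Neukirch, *Algebraic Number Theory*, Grundlehren 322 (1999), Ch. V §1 Thm. (1.1) (the class field axiom `(K^* : N L^*) = [L : K]` for cyclic `L|K`),
  Ch. II (9.6) (`G_w ≅ G(L_w|K_v)`). [NeukirchANT1999]
* J. W. S. Cassels, A. Fröhlich (eds.), *Algebraic Number Theory* (1967), Ch. VII (J. Tate) §1.1, Ch. VI (J.-P. Serre) §1.1. [CasselsFrohlichANT1967]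
* J.-P. Serre, *Local Fields*, GTM 67 (1979), Ch. XIII §4, Ch. XIV §3 (norm groups of quadratic extensions). [Serre1979]

## Tree search
`lean search 'exists_fixed_nonnorm|nonnorm_dichotomy|QuadraticLocalNormDichotomy'`: no prior declaration; the tame, unit-level twin is ★
`UnitaryGroup.exists_fixed_unit_norm_dichotomy_of_ramified(_complexConj)` (hypotheses `he : e ≠ 1`, `h2 : |2|_w = 1`), cited not restated.  Inputs: ★ (J1)
`index_range_norm_place_eq_two_of_smul_eq`, ★ (J2) `galAdicCompletionMap_algebraMap_place`, `exists_algebraMap_place_eq_of_card_eq_two`,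
`algebraMap_norm_place_eq_mul_of_card_eq_two`; Mathlib `Subgroup.index_eq_two_iff_exists_notMem_and'`, `Subgroup.mul_mem_iff_of_index_two`,
`Subgroup.mul_self_mem_of_index_two`, `Units.coe_map`, `Units.mk0`, `RingHom.injective`, `NumberField.IsCMField.complexConj_ne_one`,
`Algebra.IsQuadraticExtension.finrank_eq_two`, `IsGalois.card_aut_eq_finrank`.
-/

namespace Literature.NumberTheory.LocalFields

open NumberField IsDedekindDomain
open Literature.NumberTheory.Automorphic Literature.NumberTheory.GaloisRepresentations
open Literature.NumberTheory.GaloisRepresentations.SemiLocal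

variable {F : Type} [Field F] [NumberField F] {E : Type} [Field E] [NumberField E] [Algebra F E]
variable {v : HeightOneSpectrum (𝓞 F)}

section Quadratic

variable [IsGalois F E] (hG : Nat.card (E ≃ₐ[F] E) = 2) (w : Place F E v) {c : E ≃ₐ[F] E} (hc : c ≠ 1)
  (hw : c • (w : HeightOneSpectrum (𝓞 E)) = w)

include hG hc hw

/-! ## §1 The norm subgroup `N = N_{E_w∕F_v}(E_wˣ) ≤ F_vˣ` read inside `E_w`: `y ∈ N ↔ ∃ z, z · σ_w z = y` -/

/-- **The local norm subgroup read in `E_w`**: at a non-split place of a quadratic extension, a unit `y ∈ F_vˣ` is a local norm `N_{E_w∕F_v}(u)`, `u ∈ E_wˣ`,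
iff `algebraMap y = z · σ_w z` for some `z ∈ E_w` (★ (J2): `N x = x · σ_w x` read in `E_w`; `z ≠ 0` is automatic since `y ≠ 0`).
[cite: CasselsFrohlichANT1967, Ch. VII §1.1] [cite: NeukirchANT1999, Ch. II (9.6)] -/
theorem mem_range_unitsMap_norm_place_iff (y : (v.adicCompletion F)ˣ) :
    y ∈ (Units.map (Algebra.norm (v.adicCompletion F) :
        (w : HeightOneSpectrum (𝓞 E)).adicCompletion E →* v.adicCompletion F)).range ↔
      ∃ z : (w : HeightOneSpectrum (𝓞 E)).adicCompletion E,
        z * galAdicCompletionMap (L := E) c hw z =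
          algebraMap (v.adicCompletion F) ((w : HeightOneSpectrum (𝓞 E)).adicCompletion E) (y : v.adicCompletion F) := by
  constructor
  · rintro ⟨u, hu⟩
    refine ⟨(u : (w : HeightOneSpectrum (𝓞 E)).adicCompletion E), ?_⟩
    have hnorm : Algebra.norm (v.adicCompletion F) (u : (w : HeightOneSpectrum (𝓞 E)).adicCompletion E) = (y : v.adicCompletion F) :=
      (Units.coe_map _ u).symm.trans (congrArg Units.val hu)
    rw [← algebraMap_norm_place_eq_mul_of_card_eq_two hG w hc hw, hnorm]
  · rintro ⟨z, hz⟩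
    have hinj := (algebraMap (v.adicCompletion F) ((w : HeightOneSpectrum (𝓞 E)).adicCompletion E)).injective
    have hz0 : z ≠ 0 := by
      rintro rfl
      apply y.ne_zero
      apply hinj
      rw [map_zero, ← hz, zero_mul]
    refine ⟨Units.mk0 z hz0, Units.ext (hinj ?_)⟩
    rw [Units.coe_map, Units.val_mk0, algebraMap_norm_place_eq_mul_of_card_eq_two hG w hc hw, hz]

/-! ## §2 The dichotomy: a `σ_w`-fixed non-norm `ε ∈ F_v` and the two norm cosets `N`, `ε N` exhaust the `σ_w`-fixed non-zero elements -/

/-- **MASTER FORM — the norm trichotomy at a non-split place of a quadratic extension** (unramified, tame or WILD alike): there is `ε = algebraMap a`,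
`a ∈ F_vˣ ∖ N_{E_w∕F_v}(E_wˣ)` (so `σ_w ε = ε`, `ε ≠ 0`, and `ε ≠ z · σ_w z` for every `z`), such that every `σ_w`-fixed `s ≠ 0` of `E_w` satisfies EXACTLY ONE of:
(i) `s = z · σ_w z` for some `z` (and then `ε · s` is not of that form); (ii) `s` is not of that form, and `ε · s = z · σ_w z`, equivalently `s = ε · (z' · σ_w z')`,
for some `z`, `z'`.  PROOF: `[F_vˣ : N] = 2` (★ (J1), Neukirch V (1.1) `i = 0`) gives `a ∉ N` with `F_vˣ = N ⊔ aN` and `aN · aN = N` (Mathlib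
`Subgroup.index_eq_two_iff_exists_notMem_and'`, `Subgroup.mul_mem_iff_of_index_two`); push to `E_w` by §1 and ★ (J2) (`Fix(σ_w) = algebraMap F_v`).
[cite: NeukirchANT1999, Ch. V §1 Thm. (1.1); Ch. II (9.6)] [cite: Serre1979, Ch. XIV §3] [cite: CasselsFrohlichANT1967, Ch. VII §1.1] -/
theorem exists_fixed_nonnorm_trichotomy_of_card_eq_two :
    ∃ ε : (w : HeightOneSpectrum (𝓞 E)).adicCompletion E,
      ε ∈ Set.range (algebraMap (v.adicCompletion F) ((w : HeightOneSpectrum (𝓞 E)).adicCompletion E)) ∧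
      galAdicCompletionMap (L := E) c hw ε = ε ∧ ε ≠ 0 ∧
      (∀ z : (w : HeightOneSpectrum (𝓞 E)).adicCompletion E, z * galAdicCompletionMap (L := E) c hw z ≠ ε) ∧
      ∀ s : (w : HeightOneSpectrum (𝓞 E)).adicCompletion E, galAdicCompletionMap (L := E) c hw s = s → s ≠ 0 →
        ((∃ z : (w : HeightOneSpectrum (𝓞 E)).adicCompletion E, z * galAdicCompletionMap (L := E) c hw z = s) ∧
          ¬ ∃ z : (w : HeightOneSpectrum (𝓞 E)).adicCompletion E, z * galAdicCompletionMap (L := E) c hw z = ε * s) ∨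
        ((¬ ∃ z : (w : HeightOneSpectrum (𝓞 E)).adicCompletion E, z * galAdicCompletionMap (L := E) c hw z = s) ∧
          (∃ z : (w : HeightOneSpectrum (𝓞 E)).adicCompletion E, z * galAdicCompletionMap (L := E) c hw z = ε * s) ∧
          ∃ z : (w : HeightOneSpectrum (𝓞 E)).adicCompletion E, ε * (z * galAdicCompletionMap (L := E) c hw z) = s) := by
  have hidx := index_range_norm_place_eq_two_of_smul_eq hG w hc hw
  obtain ⟨a, ha, hall⟩ := (Subgroup.index_eq_two_iff_exists_notMem_and').mp hidx
  have hinj := (algebraMap (v.adicCompletion F) ((w : HeightOneSpectrum (𝓞 E)).adicCompletion E)).injective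
  refine ⟨algebraMap (v.adicCompletion F) ((w : HeightOneSpectrum (𝓞 E)).adicCompletion E) (a : v.adicCompletion F),
    ⟨(a : v.adicCompletion F), rfl⟩, galAdicCompletionMap_algebraMap_place w c hw _,
    (map_ne_zero_iff _ hinj).mpr a.ne_zero,
    fun z hz => ha ((mem_range_unitsMap_norm_place_iff hG w hc hw a).mpr ⟨z, hz⟩), ?_⟩
  intro s hs hs0
  obtain ⟨y, rfl⟩ := exists_algebraMap_place_eq_of_card_eq_two hG w hc hw hs
  have hy0 : y ≠ 0 := fun h => hs0 (by rw [h, map_zero])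
  -- the two cosets, read on the unit `b = y` of `F_vˣ`
  have hN : (∃ z : (w : HeightOneSpectrum (𝓞 E)).adicCompletion E, z * galAdicCompletionMap (L := E) c hw z =
      algebraMap (v.adicCompletion F) ((w : HeightOneSpectrum (𝓞 E)).adicCompletion E) y) ↔
      Units.mk0 y hy0 ∈ (Units.map (Algebra.norm (v.adicCompletion F) :
        (w : HeightOneSpectrum (𝓞 E)).adicCompletion E →* v.adicCompletion F)).range := by
    rw [mem_range_unitsMap_norm_place_iff hG w hc hw, Units.val_mk0]
  have hεN : (∃ z : (w : HeightOneSpectrum (𝓞 E)).adicCompletion E, z * galAdicCompletionMap (L := E) c hw z =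
      algebraMap (v.adicCompletion F) ((w : HeightOneSpectrum (𝓞 E)).adicCompletion E) (a : v.adicCompletion F) *
        algebraMap (v.adicCompletion F) ((w : HeightOneSpectrum (𝓞 E)).adicCompletion E) y) ↔
      a * Units.mk0 y hy0 ∈ (Units.map (Algebra.norm (v.adicCompletion F) :
        (w : HeightOneSpectrum (𝓞 E)).adicCompletion E →* v.adicCompletion F)).range := by
    rw [mem_range_unitsMap_norm_place_iff hG w hc hw, Units.val_mul, Units.val_mk0, map_mul]
  have hε'N : (∃ z : (w : HeightOneSpectrum (𝓞 E)).adicCompletion E,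
      algebraMap (v.adicCompletion F) ((w : HeightOneSpectrum (𝓞 E)).adicCompletion E) (a : v.adicCompletion F) *
        (z * galAdicCompletionMap (L := E) c hw z) =
        algebraMap (v.adicCompletion F) ((w : HeightOneSpectrum (𝓞 E)).adicCompletion E) y) ↔
      a⁻¹ * Units.mk0 y hy0 ∈ (Units.map (Algebra.norm (v.adicCompletion F) :
        (w : HeightOneSpectrum (𝓞 E)).adicCompletion E →* v.adicCompletion F)).range := by
    rw [mem_range_unitsMap_norm_place_iff hG w hc hw, Units.val_mul, Units.val_mk0, map_mul]
    have ha0 : algebraMap (v.adicCompletion F) ((w : HeightOneSpectrum (𝓞 E)).adicCompletion E) (a : v.adicCompletion F) ≠ 0 :=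
      (map_ne_zero_iff _ hinj).mpr a.ne_zero
    refine exists_congr fun z => ?_
    rw [Units.val_inv_eq_inv_val, map_inv₀, eq_inv_mul_iff_mul_eq₀ ha0]
  rcases hall (Units.mk0 y hy0) with hab | hb
  · -- `a·b ∈ N`, hence `b ∉ N` (else `a ∈ N`) and `a⁻¹·b = (a⁻¹a⁻¹)(ab) ∈ N`
    have hb : Units.mk0 y hy0 ∉ (Units.map (Algebra.norm (v.adicCompletion F) :
        (w : HeightOneSpectrum (𝓞 E)).adicCompletion E →* v.adicCompletion F)).range :=
      fun hb => ha (((Subgroup.mul_mem_iff_of_index_two hidx).mp hab).mpr hb)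
    have hab' : a⁻¹ * Units.mk0 y hy0 ∈ (Units.map (Algebra.norm (v.adicCompletion F) :
        (w : HeightOneSpectrum (𝓞 E)).adicCompletion E →* v.adicCompletion F)).range := by
      rw [show a⁻¹ * Units.mk0 y hy0 = a⁻¹ * a⁻¹ * (a * Units.mk0 y hy0) by group]
      exact mul_mem (Subgroup.mul_self_mem_of_index_two hidx a⁻¹) hab
    exact Or.inr ⟨fun h => hb (hN.mp h), hεN.mpr hab, hε'N.mpr hab'⟩
  · -- `b ∈ N`, hence `a·b ∉ N`
    have hab : a * Units.mk0 y hy0 ∉ (Units.map (Algebra.norm (v.adicCompletion F) :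
        (w : HeightOneSpectrum (𝓞 E)).adicCompletion E →* v.adicCompletion F)).range :=
      fun hab => ha (((Subgroup.mul_mem_iff_of_index_two hidx).mp hab).mpr hb)
    exact Or.inl ⟨hN.mpr hb, fun h => hab (hεN.mp h)⟩

/-- **(J3) The `σ_w`-norm dichotomy at EVERY non-split place of a quadratic extension** (LH5-p02 (g3) census §2 (J3), text token for token; no `hv2`, no
`he`): there is a `σ_w`-fixed `ε ≠ 0` which is not of the form `z · σ_w z`, and every `σ_w`-fixed `s ≠ 0` is `z · σ_w z` or has `ε · s = z · σ_w z`.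
[cite: NeukirchANT1999, Ch. V §1 Thm. (1.1); Ch. II (9.6)] [cite: Serre1979, Ch. XIV §3] [cite: CasselsFrohlichANT1967, Ch. VII §1.1] -/
theorem exists_fixed_nonnorm_dichotomy_of_card_eq_two :
    ∃ ε : (w : HeightOneSpectrum (𝓞 E)).adicCompletion E,
      galAdicCompletionMap (L := E) c hw ε = ε ∧ ε ≠ 0 ∧
      (∀ z : (w : HeightOneSpectrum (𝓞 E)).adicCompletion E, z * galAdicCompletionMap (L := E) c hw z ≠ ε) ∧
      ∀ s : (w : HeightOneSpectrum (𝓞 E)).adicCompletion E, galAdicCompletionMap (L := E) c hw s = s → s ≠ 0 →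
        (∃ z : (w : HeightOneSpectrum (𝓞 E)).adicCompletion E, z * galAdicCompletionMap (L := E) c hw z = s) ∨
        (∃ z : (w : HeightOneSpectrum (𝓞 E)).adicCompletion E, z * galAdicCompletionMap (L := E) c hw z = ε * s) := by
  obtain ⟨ε, -, hfix, hε0, hnn, hall⟩ := exists_fixed_nonnorm_trichotomy_of_card_eq_two hG w hc hw
  refine ⟨ε, hfix, hε0, hnn, fun s hs hs0 => ?_⟩
  rcases hall s hs hs0 with ⟨h, -⟩ | ⟨-, h, -⟩
  · exact Or.inl h
  · exact Or.inr h

/-- **(J3′) The `σ_w`-norm dichotomy in the CONSUMER SHAPE** of ★ `UnitaryGroup.exists_fixed_unit_norm_dichotomy_of_ramified_complexConj` ∕ the `hdich`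
hypothesis of ★ `UnitaryGroup.sq_zero_unipotent_cases_of_ramified_complexConj` (TAME twin), minus the unit clauses, at EVERY non-split place:
`σ_w ε = ε`, `ε ≠ 0`, `¬ ∃ t, t · σ_w t = ε`, and every `s ≠ 0` with `σ_w s = s` is `z · σ_w z` or `ε · (z · σ_w z)` with `z ≠ 0`.
[cite: NeukirchANT1999, Ch. V §1 Thm. (1.1); Ch. II (9.6)] [cite: Serre1979, Ch. XIV §3] [cite: CasselsFrohlichANT1967, Ch. VII §1.1] -/
theorem exists_fixed_nonnorm_dichotomy_of_card_eq_two' :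
    ∃ ε : (w : HeightOneSpectrum (𝓞 E)).adicCompletion E,
      galAdicCompletionMap (L := E) c hw ε = ε ∧ ε ≠ 0 ∧
      (¬ ∃ t : (w : HeightOneSpectrum (𝓞 E)).adicCompletion E, t * galAdicCompletionMap (L := E) c hw t = ε) ∧
      ∀ s : (w : HeightOneSpectrum (𝓞 E)).adicCompletion E, s ≠ 0 → galAdicCompletionMap (L := E) c hw s = s →
        ∃ z : (w : HeightOneSpectrum (𝓞 E)).adicCompletion E, z ≠ 0 ∧
          (s = z * galAdicCompletionMap (L := E) c hw z ∨ s = ε * (z * galAdicCompletionMap (L := E) c hw z)) := by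
  obtain ⟨ε, -, hfix, hε0, hnn, hall⟩ := exists_fixed_nonnorm_trichotomy_of_card_eq_two hG w hc hw
  refine ⟨ε, hfix, hε0, fun ⟨t, ht⟩ => hnn t ht, fun s hs0 hs => ?_⟩
  rcases hall s hs hs0 with ⟨⟨z, hz⟩, -⟩ | ⟨-, -, ⟨z, hz⟩⟩
  · refine ⟨z, ?_, Or.inl hz.symm⟩
    rintro rfl
    exact hs0 (by rw [← hz, zero_mul])
  · refine ⟨z, ?_, Or.inr hz.symm⟩
    rintro rfl
    exact hs0 (by rw [← hz, zero_mul, mul_zero])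

/-- **The product of two `σ_w`-fixed non-norms is a norm** (`aN · aN = N` for the index-two subgroup `N`): if `s, t ≠ 0` are `σ_w`-fixed and neither is of the
form `z · σ_w z`, then `s · t = z · σ_w z` for some `z`. [cite: NeukirchANT1999, Ch. V §1 Thm. (1.1)] [cite: Serre1979, Ch. XIV §3] -/
theorem exists_mul_galAdicCompletionMap_eq_mul_of_not_exists {s t : (w : HeightOneSpectrum (𝓞 E)).adicCompletion E}
    (hs : galAdicCompletionMap (L := E) c hw s = s) (hs0 : s ≠ 0)
    (ht : galAdicCompletionMap (L := E) c hw t = t) (ht0 : t ≠ 0)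
    (hns : ∀ z : (w : HeightOneSpectrum (𝓞 E)).adicCompletion E, z * galAdicCompletionMap (L := E) c hw z ≠ s)
    (hnt : ∀ z : (w : HeightOneSpectrum (𝓞 E)).adicCompletion E, z * galAdicCompletionMap (L := E) c hw z ≠ t) :
    ∃ z : (w : HeightOneSpectrum (𝓞 E)).adicCompletion E, z * galAdicCompletionMap (L := E) c hw z = s * t := by
  have hidx := index_range_norm_place_eq_two_of_smul_eq hG w hc hw
  obtain ⟨y, rfl⟩ := exists_algebraMap_place_eq_of_card_eq_two hG w hc hw hs
  obtain ⟨y', rfl⟩ := exists_algebraMap_place_eq_of_card_eq_two hG w hc hw ht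
  have hy0 : y ≠ 0 := fun h => hs0 (by rw [h, map_zero])
  have hy'0 : y' ≠ 0 := fun h => ht0 (by rw [h, map_zero])
  have hb : Units.mk0 y hy0 ∉ (Units.map (Algebra.norm (v.adicCompletion F) :
      (w : HeightOneSpectrum (𝓞 E)).adicCompletion E →* v.adicCompletion F)).range := fun h => by
    obtain ⟨z, hz⟩ := (mem_range_unitsMap_norm_place_iff hG w hc hw _).mp h
    exact hns z (by rw [hz, Units.val_mk0])
  have hb' : Units.mk0 y' hy'0 ∉ (Units.map (Algebra.norm (v.adicCompletion F) :
      (w : HeightOneSpectrum (𝓞 E)).adicCompletion E →* v.adicCompletion F)).range := fun h => by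
    obtain ⟨z, hz⟩ := (mem_range_unitsMap_norm_place_iff hG w hc hw _).mp h
    exact hnt z (by rw [hz, Units.val_mk0])
  have hprod : Units.mk0 y hy0 * Units.mk0 y' hy'0 ∈ (Units.map (Algebra.norm (v.adicCompletion F) :
      (w : HeightOneSpectrum (𝓞 E)).adicCompletion E →* v.adicCompletion F)).range :=
    (Subgroup.mul_mem_iff_of_index_two hidx).mpr ⟨fun h => absurd h hb, fun h => absurd h hb'⟩
  obtain ⟨z, hz⟩ := (mem_range_unitsMap_norm_place_iff hG w hc hw _).mp hprod
  exact ⟨z, by rw [hz, Units.val_mul, Units.val_mk0, Units.val_mk0, map_mul]⟩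

end Quadratic

/-! ## §3 CM fields `L ∕ L⁺`: the consumers' spelling (`IsCMField.complexConj L`, `UnitaryGroup.PlacesOver L v = SemiLocal.Place L⁺ L v`) -/

section CM

variable (L : Type) [Field L] [NumberField L] [IsCMField L] {v : HeightOneSpectrum (𝓞 ↥(maximalRealSubfield L))}
  (w : Place ↥(maximalRealSubfield L) L v)

/-- `#Gal(L ∕ L⁺) = 2` for a CM field `L` (Mathlib: `L ∕ L⁺` is a Galois quadratic extension). [folklore] -/
private theorem IsCMField.natCard_algEquiv_eq_two'' : Nat.card (L ≃ₐ[↥(maximalRealSubfield L)] L) = 2 := by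
  rw [IsGalois.card_aut_eq_finrank, Algebra.IsQuadraticExtension.finrank_eq_two]

/-- **CM master form**: at a place `w` of the CM field `L` fixed by complex conjugation (NON-SPLIT in `L ∕ L⁺`: inert, tamely or WILDLY ramified alike), with
`σ_w = galAdicCompletionMap (IsCMField.complexConj L) hw`, the norm trichotomy of §2 (`ε ∈ algebraMap L⁺_v`, `σ_w ε = ε ≠ 0` non-norm; every `σ_w`-fixed
`s ≠ 0` is EXACTLY ONE of `z · σ_w z` ∕ `ε⁻¹`-times such). [cite: NeukirchANT1999, Ch. V §1 Thm. (1.1); Ch. II (9.6)] [cite: Serre1979, Ch. XIV §3] -/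
theorem IsCMField.exists_fixed_nonnorm_trichotomy (hw : IsCMField.complexConj L • (w : HeightOneSpectrum (𝓞 L)) = w) :
    ∃ ε : (w : HeightOneSpectrum (𝓞 L)).adicCompletion L,
      ε ∈ Set.range (algebraMap (v.adicCompletion ↥(maximalRealSubfield L)) ((w : HeightOneSpectrum (𝓞 L)).adicCompletion L)) ∧
      galAdicCompletionMap (L := L) (IsCMField.complexConj L) hw ε = ε ∧ ε ≠ 0 ∧
      (∀ z : (w : HeightOneSpectrum (𝓞 L)).adicCompletion L, z * galAdicCompletionMap (L := L) (IsCMField.complexConj L) hw z ≠ ε) ∧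
      ∀ s : (w : HeightOneSpectrum (𝓞 L)).adicCompletion L, galAdicCompletionMap (L := L) (IsCMField.complexConj L) hw s = s → s ≠ 0 →
        ((∃ z : (w : HeightOneSpectrum (𝓞 L)).adicCompletion L, z * galAdicCompletionMap (L := L) (IsCMField.complexConj L) hw z = s) ∧
          ¬ ∃ z : (w : HeightOneSpectrum (𝓞 L)).adicCompletion L, z * galAdicCompletionMap (L := L) (IsCMField.complexConj L) hw z = ε * s) ∨
        ((¬ ∃ z : (w : HeightOneSpectrum (𝓞 L)).adicCompletion L, z * galAdicCompletionMap (L := L) (IsCMField.complexConj L) hw z = s) ∧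
          (∃ z : (w : HeightOneSpectrum (𝓞 L)).adicCompletion L, z * galAdicCompletionMap (L := L) (IsCMField.complexConj L) hw z = ε * s) ∧
          ∃ z : (w : HeightOneSpectrum (𝓞 L)).adicCompletion L, ε * (z * galAdicCompletionMap (L := L) (IsCMField.complexConj L) hw z) = s) :=
  exists_fixed_nonnorm_trichotomy_of_card_eq_two (IsCMField.natCard_algEquiv_eq_two'' L) w (IsCMField.complexConj_ne_one L) hw

/-- **(J3) for CM fields** — the `σ_w`-norm dichotomy at EVERY non-split place of `L ∕ L⁺` (census text): `σ_w ε = ε`, `ε ≠ 0`, `ε ≠ z · σ_w z`, and every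
`σ_w`-fixed `s ≠ 0` is `z · σ_w z` or has `ε · s = z · σ_w z`. [cite: NeukirchANT1999, Ch. V §1 Thm. (1.1); Ch. II (9.6)] [cite: Serre1979, Ch. XIV §3] -/
theorem IsCMField.exists_fixed_nonnorm_dichotomy (hw : IsCMField.complexConj L • (w : HeightOneSpectrum (𝓞 L)) = w) :
    ∃ ε : (w : HeightOneSpectrum (𝓞 L)).adicCompletion L,
      galAdicCompletionMap (L := L) (IsCMField.complexConj L) hw ε = ε ∧ ε ≠ 0 ∧
      (∀ z : (w : HeightOneSpectrum (𝓞 L)).adicCompletion L, z * galAdicCompletionMap (L := L) (IsCMField.complexConj L) hw z ≠ ε) ∧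
      ∀ s : (w : HeightOneSpectrum (𝓞 L)).adicCompletion L, galAdicCompletionMap (L := L) (IsCMField.complexConj L) hw s = s → s ≠ 0 →
        (∃ z : (w : HeightOneSpectrum (𝓞 L)).adicCompletion L, z * galAdicCompletionMap (L := L) (IsCMField.complexConj L) hw z = s) ∨
        (∃ z : (w : HeightOneSpectrum (𝓞 L)).adicCompletion L, z * galAdicCompletionMap (L := L) (IsCMField.complexConj L) hw z = ε * s) :=
  exists_fixed_nonnorm_dichotomy_of_card_eq_two (IsCMField.natCard_algEquiv_eq_two'' L) w (IsCMField.complexConj_ne_one L) hw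

/-- **(J3′) for CM fields — CONSUMER SHAPE** (★ `exists_fixed_unit_norm_dichotomy_of_ramified_complexConj` minus the unit clauses, no `he`, no `h2`):
`σ_w ε = ε`, `ε ≠ 0`, `¬ ∃ t, t · σ_w t = ε`, and every `s ≠ 0` with `σ_w s = s` is `z · σ_w z` or `ε · (z · σ_w z)` with `z ≠ 0`.
[cite: NeukirchANT1999, Ch. V §1 Thm. (1.1); Ch. II (9.6)] [cite: Serre1979, Ch. XIV §3] -/
theorem IsCMField.exists_fixed_nonnorm_dichotomy' (hw : IsCMField.complexConj L • (w : HeightOneSpectrum (𝓞 L)) = w) :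
    ∃ ε : (w : HeightOneSpectrum (𝓞 L)).adicCompletion L,
      galAdicCompletionMap (L := L) (IsCMField.complexConj L) hw ε = ε ∧ ε ≠ 0 ∧
      (¬ ∃ t : (w : HeightOneSpectrum (𝓞 L)).adicCompletion L, t * galAdicCompletionMap (L := L) (IsCMField.complexConj L) hw t = ε) ∧
      ∀ s : (w : HeightOneSpectrum (𝓞 L)).adicCompletion L, s ≠ 0 → galAdicCompletionMap (L := L) (IsCMField.complexConj L) hw s = s →
        ∃ z : (w : HeightOneSpectrum (𝓞 L)).adicCompletion L, z ≠ 0 ∧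
          (s = z * galAdicCompletionMap (L := L) (IsCMField.complexConj L) hw z ∨
            s = ε * (z * galAdicCompletionMap (L := L) (IsCMField.complexConj L) hw z)) :=
  exists_fixed_nonnorm_dichotomy_of_card_eq_two' (IsCMField.natCard_algEquiv_eq_two'' L) w (IsCMField.complexConj_ne_one L) hw

/-- At a place `v` of `L⁺` with a SINGLE place `w` of the CM field `L` above it, complex conjugation fixes `w` (the `hsub : Subsingleton (UnitaryGroup.PlacesOver L v)`
frame of ★ `ShalikaGermExpansionUnitaryThreeNonsplitCM` and the LH4 leaf supplies the `hw` of the σ_w-currency files). [cite: CasselsFrohlichANT1967, Ch. VII §1.1] -/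
theorem IsCMField.complexConj_smul_eq_of_subsingleton (hsub : Subsingleton (Place ↥(maximalRealSubfield L) L v)) :
    IsCMField.complexConj L • (w : HeightOneSpectrum (𝓞 L)) = w :=
  congrArg Place.val (Subsingleton.elim (IsCMField.complexConj L • w) w)

/-- **(J3′) in the `Subsingleton`-frame**: when `w` is the ONLY place of `L` above `v`, the consumer-shape norm dichotomy holds for
`σ_w = galAdicCompletionMap (IsCMField.complexConj L) (IsCMField.complexConj_smul_eq_of_subsingleton L w hsub)` (proof-irrelevant in that argument, so it
matches any `hw` the consumer holds). [cite: NeukirchANT1999, Ch. V §1 Thm. (1.1); Ch. II (9.6)] [cite: Serre1979, Ch. XIV §3] -/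
theorem IsCMField.exists_fixed_nonnorm_dichotomy_of_subsingleton' (hsub : Subsingleton (Place ↥(maximalRealSubfield L) L v)) :
    ∃ ε : (w : HeightOneSpectrum (𝓞 L)).adicCompletion L,
      galAdicCompletionMap (L := L) (IsCMField.complexConj L) (IsCMField.complexConj_smul_eq_of_subsingleton L w hsub) ε = ε ∧ ε ≠ 0 ∧
      (¬ ∃ t : (w : HeightOneSpectrum (𝓞 L)).adicCompletion L,
        t * galAdicCompletionMap (L := L) (IsCMField.complexConj L) (IsCMField.complexConj_smul_eq_of_subsingleton L w hsub) t = ε) ∧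
      ∀ s : (w : HeightOneSpectrum (𝓞 L)).adicCompletion L, s ≠ 0 →
        galAdicCompletionMap (L := L) (IsCMField.complexConj L) (IsCMField.complexConj_smul_eq_of_subsingleton L w hsub) s = s →
        ∃ z : (w : HeightOneSpectrum (𝓞 L)).adicCompletion L, z ≠ 0 ∧
          (s = z * galAdicCompletionMap (L := L) (IsCMField.complexConj L) (IsCMField.complexConj_smul_eq_of_subsingleton L w hsub) z ∨
            s = ε * (z * galAdicCompletionMap (L := L) (IsCMField.complexConj L) (IsCMField.complexConj_smul_eq_of_subsingleton L w hsub) z)) :=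
  IsCMField.exists_fixed_nonnorm_dichotomy' L w (IsCMField.complexConj_smul_eq_of_subsingleton L w hsub)

end CM

end Literature.NumberTheory.LocalFields
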